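import Mathlib
import HarnessLib
import Summits.Ventures.LatticeQCDFlow.Exactness.SU2StapleFieldCovariance
import Summits.Ventures.LatticeQCDFlow.Exactness.SU2MaskedKickSchedule

/-!
# The booked Jacobian of a gauge-equivariant `SU(2)` kick layer is gauge invariant; so are the running log-det of a member and the pulled-back action `S∘F − log J`

HONEST FRAMING: exact (Metropolis-corrected) sampling algorithms for lattice gauge theory;
figures of merit are autocorrelation/cost numbers at stated couplings and volumes; no
continuum-physics claim.

Venture `LatticeQCDFlow` (cell pub-lqcd), topic `Exactness`; FANOUT row 14 (`eng-flowhmc`, engine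
`latflow.fthmc`, family B).  NEW WORK of the cell; nothing is cited as a fact; no number.
`SU2StapleFieldCovariance.lean` showed the engine's LO / learned `SU(2)` layers are gauge
EQUIVARIANT.  Field-transformed HMC also books, per layer, the log-det
`Σ_active log j̃_e(V)` with `j̃_e(V)` a function of `‖J_e(V)‖` and of the angle between `J_e(V)`
and `vecQuat V_e` (`SU2MaskedKickLayer.lean`).  Here: these quantities are gauge INVARIANT, hence
so is the pulled-back action `S_eff = S∘F − log J` the engine integrates (for any invariant `S`,
e.g. the Wilson action).

* `vecQuat_conj_add`, `norm_vecQuat_conj`, `inner_vecQuat_conj`, `angle_vecQuat_conj` — the map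
  `x ↦ vecQuat (g · quatVec x · hᴴ)` of `ℝ⁴` (`g, h ∈ SU(2)`) is additive, norm-, inner-product- and
  angle-preserving (polarisation; `|det|` bookkeeping of quaternions);
* `norm_eq_of_quatVec_conj`, `angle_link_eq_of_quatVec_conj` — if a local field transforms like
  the link then `‖J'‖ = ‖J‖` and `∠(J', vecQuat (g U h⁻¹)) = ∠(J, vecQuat U)`;
* **`isGaugeInvariant_su2MaskedKickJacobian`** — for ANY mask and ANY field transforming like a
  link at active links, the booked density `∏_active j̃_e` (repaired closed form, verbatim as in
  `SU2MaskedKickSchedule.exists_layers_su2MaskedKick`) is `IsGaugeInvariant`; instances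
  **`isGaugeInvariant_su2WilsonFlowLOJacobian`** (the LO member's booked density of
  `su2WilsonFlowLOSubstep_certified`, VERBATIM) and **`isGaugeInvariant_su2ResidualJacobian`**
  (learned layers with invariant weights);
* member level, ANY group: **`isGaugeEquivariant_foldr_trans`** (a schedule of equivariant layers
  composes to an equivariant member), **`isGaugeInvariant_foldr_logDet`** (its running log-det —
  the engine's accumulated `logdet` — is invariant), `gauge_of_layers_map_eq` (transfer through
  the `layers.map … = sched.map …` packaging of the `exists_layers_*` theorems);
* **`isGaugeInvariant_ftAction`** — `S∘F − log J` is gauge invariant for invariant `S`,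
  equivariant `F`, invariant `J`; `isGaugeInvariant_ftAction_wilson` (the Wilson action, by the
  tree's `isGaugeInvariant_wilsonAction`).

NOT CLAIMED: anything about the momenta / forces (the typed kernels refresh flat Gaussian
momenta; covariance of the autodiff force is not a typed object here); `SU(N ≥ 3)`; any number.
-/

noncomputable section

namespace Summit.Ventures.LatticeQCDFlow.Exactness

open Real WithLp InnerProductGeometry MeasureTheory
open Literature.MathematicalPhysics.QuantumFieldTheory
open scoped Matrix RealInnerProductSpace

variable {d L : ℕ}

/-! ## Conjugation by `SU(2) × SU(2)` is an isometry of `ℝ⁴` (quaternion coordinates) -/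

section Conj

/-- `x ↦ vecQuat (G · quatVec x · Hᴴ)` is additive. -/
theorem vecQuat_conj_add (G H : Matrix (Fin 2) (Fin 2) ℂ) (x y : R4) :
    vecQuat (G * quatVec (x + y) * Hᴴ) = vecQuat (G * quatVec x * Hᴴ) + vecQuat (G * quatVec y * Hᴴ) := by
  rw [quatVec_add, Matrix.mul_add, Matrix.add_mul, vecQuat_add]

/-- `x ↦ vecQuat (g · quatVec x · hᴴ)` preserves the norm for `g, h ∈ SU(2)` (`|g Q hᴴ|² = det = |Q|²`). -/
theorem norm_vecQuat_conj (G H : Matrix.specialUnitaryGroup (Fin 2) ℂ) (x : R4) :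
    ‖vecQuat ((G : Matrix (Fin 2) (Fin 2) ℂ) * quatVec x * (H : Matrix (Fin 2) (Fin 2) ℂ)ᴴ)‖ = ‖x‖ := by
  have hq : IsQuat (quatVec x * (H : Matrix (Fin 2) (Fin 2) ℂ)ᴴ) :=
    (isQuat_quatVec x).mul (IsQuat.of_mem_specialUnitaryGroup H.2).conjTranspose
  have h1 : IsQuat.normSq (quatVec x * (H : Matrix (Fin 2) (Fin 2) ℂ)ᴴ) = IsQuat.normSq (quatVec x) := by
    have hd := hq.det_eq
    rw [Matrix.det_mul, Matrix.det_conjTranspose, (Matrix.mem_specialUnitaryGroup_iff.mp H.2).2, star_one,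
      mul_one, (isQuat_quatVec x).det_eq] at hd
    exact_mod_cast hd.symm
  have h : ‖vecQuat ((G : Matrix (Fin 2) (Fin 2) ℂ) * quatVec x * (H : Matrix (Fin 2) (Fin 2) ℂ)ᴴ)‖ ^ 2 = ‖x‖ ^ 2 := by
    rw [norm_vecQuat_sq, Matrix.mul_assoc, IsQuat.normSq_mul_of_mem G.2 hq, h1, normSq_quatVec]
  exact (pow_left_inj₀ (norm_nonneg _) (norm_nonneg _) two_ne_zero).1 h

/-- `x ↦ vecQuat (g · quatVec x · hᴴ)` preserves inner products (polarisation). -/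
theorem inner_vecQuat_conj (G H : Matrix.specialUnitaryGroup (Fin 2) ℂ) (x y : R4) :
    ⟪vecQuat ((G : Matrix (Fin 2) (Fin 2) ℂ) * quatVec x * (H : Matrix (Fin 2) (Fin 2) ℂ)ᴴ),
      vecQuat ((G : Matrix (Fin 2) (Fin 2) ℂ) * quatVec y * (H : Matrix (Fin 2) (Fin 2) ℂ)ᴴ)⟫ = ⟪x, y⟫ := by
  rw [real_inner_eq_norm_add_mul_self_sub_norm_mul_self_sub_norm_mul_self_div_two,
    real_inner_eq_norm_add_mul_self_sub_norm_mul_self_sub_norm_mul_self_div_two, ← vecQuat_conj_add,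
    norm_vecQuat_conj, norm_vecQuat_conj, norm_vecQuat_conj]

/-- `x ↦ vecQuat (g · quatVec x · hᴴ)` preserves angles. -/
theorem angle_vecQuat_conj (G H : Matrix.specialUnitaryGroup (Fin 2) ℂ) (x y : R4) :
    angle (vecQuat ((G : Matrix (Fin 2) (Fin 2) ℂ) * quatVec x * (H : Matrix (Fin 2) (Fin 2) ℂ)ᴴ))
      (vecQuat ((G : Matrix (Fin 2) (Fin 2) ℂ) * quatVec y * (H : Matrix (Fin 2) (Fin 2) ℂ)ᴴ)) = angle x y := by
  unfold angle
  rw [inner_vecQuat_conj, norm_vecQuat_conj, norm_vecQuat_conj]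

/-- If a local field transforms like the link, its norm is unchanged. -/
theorem norm_eq_of_quatVec_conj (gx gy : Matrix.specialUnitaryGroup (Fin 2) ℂ) {J J' : R4}
    (hJ : quatVec J' = (gx : Matrix (Fin 2) (Fin 2) ℂ) * quatVec J * (gy : Matrix (Fin 2) (Fin 2) ℂ)ᴴ) :
    ‖J'‖ = ‖J‖ := by
  have h : J' = vecQuat ((gx : Matrix (Fin 2) (Fin 2) ℂ) * quatVec J * (gy : Matrix (Fin 2) (Fin 2) ℂ)ᴴ) := by
    rw [← hJ, vecQuat_quatVec]
  rw [h, norm_vecQuat_conj]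

/-- If a local field transforms like the link `U ↦ g_x U g_y⁻¹`, the angle between the field and
the link (in quaternion coordinates) is unchanged. -/
theorem angle_link_eq_of_quatVec_conj (gx gy U : Matrix.specialUnitaryGroup (Fin 2) ℂ) {J J' : R4}
    (hJ : quatVec J' = (gx : Matrix (Fin 2) (Fin 2) ℂ) * quatVec J * (gy : Matrix (Fin 2) (Fin 2) ℂ)ᴴ) :
    angle J' (vecQuat ((gx * U * gy⁻¹ : Matrix.specialUnitaryGroup (Fin 2) ℂ) : Matrix (Fin 2) (Fin 2) ℂ)) =
      angle J (vecQuat (U : Matrix (Fin 2) (Fin 2) ℂ)) := by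
  have h1 : J' = vecQuat ((gx : Matrix (Fin 2) (Fin 2) ℂ) * quatVec J * (gy : Matrix (Fin 2) (Fin 2) ℂ)ᴴ) := by
    rw [← hJ, vecQuat_quatVec]
  have h2 : vecQuat ((gx * U * gy⁻¹ : Matrix.specialUnitaryGroup (Fin 2) ℂ) : Matrix (Fin 2) (Fin 2) ℂ) =
      vecQuat ((gx : Matrix (Fin 2) (Fin 2) ℂ) * quatVec (vecQuat (U : Matrix (Fin 2) (Fin 2) ℂ)) *
        (gy : Matrix (Fin 2) (Fin 2) ℂ)ᴴ) := by
    rw [quatVec_vecQuat_coe, WilsonFlow.coe_mul_SU, WilsonFlow.coe_mul_SU, WilsonFlow.coe_inv_SU]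
  rw [h1, h2, angle_vecQuat_conj]

end Conj

/-! ## The booked density of an `SU(2)` kick layer is gauge invariant -/

section Layer

variable [NeZero L] (p : Edge d L → Prop) [DecidablePred p]

/-- **The booked Jacobian of a masked `SU(2)` kick layer is gauge invariant** whenever the local
field transforms like a link at active links: the product over active links of the repaired
per-link densities `j̃_e(V)` (a function of `‖J_e(V)‖` and `∠(J_e(V), vecQuat V_e)` only) takes the
same value at `V^g` and `V` — any mask, any step `ε`. -/
theorem isGaugeInvariant_su2MaskedKickJacobian (ε : ℝ)
    (J : GaugeConfig d L (Matrix.specialUnitaryGroup (Fin 2) ℂ) → Edge d L → R4)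
    (hJ : ∀ (g : Site d L → Matrix.specialUnitaryGroup (Fin 2) ℂ)
      (V : GaugeConfig d L (Matrix.specialUnitaryGroup (Fin 2) ℂ)) (e : Edge d L), p e →
        quatVec (J (gaugeTransform g V) e) =
          (g e.1 : Matrix (Fin 2) (Fin 2) ℂ) * quatVec (J V e) * (g (e.1.shift e.2) : Matrix (Fin 2) (Fin 2) ℂ)ᴴ) :
    IsGaugeInvariant (fun V : GaugeConfig d L (Matrix.specialUnitaryGroup (Fin 2) ℂ) => ∏ a : {e : Edge d L // p e},
      (if Real.sin (angle (J V a.1) (vecQuat ((V a.1 : Matrix.specialUnitaryGroup (Fin 2) ℂ) : Matrix (Fin 2) (Fin 2) ℂ))) = 0 then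
          (1 - ε * ‖J V a.1‖ * Real.cos (angle (J V a.1) (vecQuat ((V a.1 : Matrix.specialUnitaryGroup (Fin 2) ℂ) : Matrix (Fin 2) (Fin 2) ℂ)))) ^ 3
        else kickJac (ε * ‖J V a.1‖) 2 (angle (J V a.1) (vecQuat ((V a.1 : Matrix.specialUnitaryGroup (Fin 2) ℂ) : Matrix (Fin 2) (Fin 2) ℂ))))) := by
  intro g V
  refine Finset.prod_congr rfl fun a _ => ?_
  have hgt : gaugeTransform g V a.1 = g a.1.1 * V a.1 * (g (a.1.1.shift a.1.2))⁻¹ := rfl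
  have hn : ‖J (gaugeTransform g V) a.1‖ = ‖J V a.1‖ := norm_eq_of_quatVec_conj _ _ (hJ g V a.1 a.2)
  have ha : angle (J (gaugeTransform g V) a.1)
      (vecQuat ((gaugeTransform g V a.1 : Matrix.specialUnitaryGroup (Fin 2) ℂ) : Matrix (Fin 2) (Fin 2) ℂ)) =
      angle (J V a.1) (vecQuat ((V a.1 : Matrix.specialUnitaryGroup (Fin 2) ℂ) : Matrix (Fin 2) (Fin 2) ℂ)) := by
    rw [hgt]
    exact angle_link_eq_of_quatVec_conj _ _ _ (hJ g V a.1 a.2)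
  rw [hn, ha]

/-- **The LO member's booked density is gauge invariant** (any mask `p`, any `ε`): the field is
the conjugate staple sum, which transforms like a link (`quatVec_stapleJ_gaugeTransform`). -/
theorem isGaugeInvariant_su2WilsonFlowLOJacobian_mask (ε : ℝ) :
    IsGaugeInvariant (fun V : GaugeConfig d L (Matrix.specialUnitaryGroup (Fin 2) ℂ) => ∏ a : {e : Edge d L // p e},
      (if Real.sin (angle (∑ ν ∈ Finset.univ.erase a.1.2,
            (vecQuat (((V (Site.shift a.1.1 a.1.2, ν) * (V (Site.shift a.1.1 ν, a.1.2))⁻¹ * (V (a.1.1, ν))⁻¹)⁻¹ : (Matrix.specialUnitaryGroup (Fin 2) ℂ)) : Matrix (Fin 2) (Fin 2) ℂ) +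
              vecQuat ((((V (Site.shift (a.1.1 - Pi.single ν 1) a.1.2, ν))⁻¹ * (V (a.1.1 - Pi.single ν 1, a.1.2))⁻¹ * V (a.1.1 - Pi.single ν 1, ν))⁻¹ : (Matrix.specialUnitaryGroup (Fin 2) ℂ)) : Matrix (Fin 2) (Fin 2) ℂ))) (vecQuat ((V a.1 : (Matrix.specialUnitaryGroup (Fin 2) ℂ)) : Matrix (Fin 2) (Fin 2) ℂ))) = 0 then
            (1 - ε * ‖(∑ ν ∈ Finset.univ.erase a.1.2,
            (vecQuat (((V (Site.shift a.1.1 a.1.2, ν) * (V (Site.shift a.1.1 ν, a.1.2))⁻¹ * (V (a.1.1, ν))⁻¹)⁻¹ : (Matrix.specialUnitaryGroup (Fin 2) ℂ)) : Matrix (Fin 2) (Fin 2) ℂ) +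
              vecQuat ((((V (Site.shift (a.1.1 - Pi.single ν 1) a.1.2, ν))⁻¹ * (V (a.1.1 - Pi.single ν 1, a.1.2))⁻¹ * V (a.1.1 - Pi.single ν 1, ν))⁻¹ : (Matrix.specialUnitaryGroup (Fin 2) ℂ)) : Matrix (Fin 2) (Fin 2) ℂ)))‖ * Real.cos (angle (∑ ν ∈ Finset.univ.erase a.1.2,
            (vecQuat (((V (Site.shift a.1.1 a.1.2, ν) * (V (Site.shift a.1.1 ν, a.1.2))⁻¹ * (V (a.1.1, ν))⁻¹)⁻¹ : (Matrix.specialUnitaryGroup (Fin 2) ℂ)) : Matrix (Fin 2) (Fin 2) ℂ) +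
              vecQuat ((((V (Site.shift (a.1.1 - Pi.single ν 1) a.1.2, ν))⁻¹ * (V (a.1.1 - Pi.single ν 1, a.1.2))⁻¹ * V (a.1.1 - Pi.single ν 1, ν))⁻¹ : (Matrix.specialUnitaryGroup (Fin 2) ℂ)) : Matrix (Fin 2) (Fin 2) ℂ))) (vecQuat ((V a.1 : (Matrix.specialUnitaryGroup (Fin 2) ℂ)) : Matrix (Fin 2) (Fin 2) ℂ)))) ^ 3
          else kickJac (ε * ‖(∑ ν ∈ Finset.univ.erase a.1.2,
            (vecQuat (((V (Site.shift a.1.1 a.1.2, ν) * (V (Site.shift a.1.1 ν, a.1.2))⁻¹ * (V (a.1.1, ν))⁻¹)⁻¹ : (Matrix.specialUnitaryGroup (Fin 2) ℂ)) : Matrix (Fin 2) (Fin 2) ℂ) +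
              vecQuat ((((V (Site.shift (a.1.1 - Pi.single ν 1) a.1.2, ν))⁻¹ * (V (a.1.1 - Pi.single ν 1, a.1.2))⁻¹ * V (a.1.1 - Pi.single ν 1, ν))⁻¹ : (Matrix.specialUnitaryGroup (Fin 2) ℂ)) : Matrix (Fin 2) (Fin 2) ℂ)))‖) 2 (angle (∑ ν ∈ Finset.univ.erase a.1.2,
            (vecQuat (((V (Site.shift a.1.1 a.1.2, ν) * (V (Site.shift a.1.1 ν, a.1.2))⁻¹ * (V (a.1.1, ν))⁻¹)⁻¹ : (Matrix.specialUnitaryGroup (Fin 2) ℂ)) : Matrix (Fin 2) (Fin 2) ℂ) +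
              vecQuat ((((V (Site.shift (a.1.1 - Pi.single ν 1) a.1.2, ν))⁻¹ * (V (a.1.1 - Pi.single ν 1, a.1.2))⁻¹ * V (a.1.1 - Pi.single ν 1, ν))⁻¹ : (Matrix.specialUnitaryGroup (Fin 2) ℂ)) : Matrix (Fin 2) (Fin 2) ℂ))) (vecQuat ((V a.1 : (Matrix.specialUnitaryGroup (Fin 2) ℂ)) : Matrix (Fin 2) (Fin 2) ℂ))))) := by
  -- (instantiate, then β-reduce BEFORE comparing with the goal: the unifier does not β-reduce
  -- the substituted field eagerly and times out on the raw instance)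
  have h := isGaugeInvariant_su2MaskedKickJacobian p ε
    (fun (V : GaugeConfig d L (Matrix.specialUnitaryGroup (Fin 2) ℂ)) (e : Edge d L) => ∑ ν ∈ Finset.univ.erase e.2,
      (vecQuat (((V (Site.shift e.1 e.2, ν) * (V (Site.shift e.1 ν, e.2))⁻¹ * (V (e.1, ν))⁻¹)⁻¹ : Matrix.specialUnitaryGroup (Fin 2) ℂ) : Matrix (Fin 2) (Fin 2) ℂ) +
        vecQuat ((((V (Site.shift (e.1 - Pi.single ν 1) e.2, ν))⁻¹ * (V (e.1 - Pi.single ν 1, e.2))⁻¹ * V (e.1 - Pi.single ν 1, ν))⁻¹ : Matrix.specialUnitaryGroup (Fin 2) ℂ) : Matrix (Fin 2) (Fin 2) ℂ)))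
    (fun g V e _ => by beta_reduce; exact quatVec_stapleJ_gaugeTransform g V e)
  beta_reduce at h
  exact h

variable {X : Type*} [DecidableEq X] (χ : Site d L → X)

/-- **The booked density of the engine's LO sub-step `(μ, b)` — the fourth conjunct of
`su2WilsonFlowLOSubstep_certified`, VERBATIM — is gauge invariant** (any colouring, any `ε`). -/
theorem isGaugeInvariant_su2WilsonFlowLOJacobian (μ : Fin d) (b : X) (ε : ℝ) :
    IsGaugeInvariant (fun V : GaugeConfig d L ((Matrix.specialUnitaryGroup (Fin 2) ℂ)) => ∏ a : {e : Edge d L // e.2 = μ ∧ χ e.1 = b},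
          (if Real.sin (angle (∑ ν ∈ Finset.univ.erase a.1.2,
            (vecQuat (((V (Site.shift a.1.1 a.1.2, ν) * (V (Site.shift a.1.1 ν, a.1.2))⁻¹ * (V (a.1.1, ν))⁻¹)⁻¹ : (Matrix.specialUnitaryGroup (Fin 2) ℂ)) : Matrix (Fin 2) (Fin 2) ℂ) +
              vecQuat ((((V (Site.shift (a.1.1 - Pi.single ν 1) a.1.2, ν))⁻¹ * (V (a.1.1 - Pi.single ν 1, a.1.2))⁻¹ * V (a.1.1 - Pi.single ν 1, ν))⁻¹ : (Matrix.specialUnitaryGroup (Fin 2) ℂ)) : Matrix (Fin 2) (Fin 2) ℂ))) (vecQuat ((V a.1 : (Matrix.specialUnitaryGroup (Fin 2) ℂ)) : Matrix (Fin 2) (Fin 2) ℂ))) = 0 then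
            (1 - ε * ‖(∑ ν ∈ Finset.univ.erase a.1.2,
            (vecQuat (((V (Site.shift a.1.1 a.1.2, ν) * (V (Site.shift a.1.1 ν, a.1.2))⁻¹ * (V (a.1.1, ν))⁻¹)⁻¹ : (Matrix.specialUnitaryGroup (Fin 2) ℂ)) : Matrix (Fin 2) (Fin 2) ℂ) +
              vecQuat ((((V (Site.shift (a.1.1 - Pi.single ν 1) a.1.2, ν))⁻¹ * (V (a.1.1 - Pi.single ν 1, a.1.2))⁻¹ * V (a.1.1 - Pi.single ν 1, ν))⁻¹ : (Matrix.specialUnitaryGroup (Fin 2) ℂ)) : Matrix (Fin 2) (Fin 2) ℂ)))‖ * Real.cos (angle (∑ ν ∈ Finset.univ.erase a.1.2,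
            (vecQuat (((V (Site.shift a.1.1 a.1.2, ν) * (V (Site.shift a.1.1 ν, a.1.2))⁻¹ * (V (a.1.1, ν))⁻¹)⁻¹ : (Matrix.specialUnitaryGroup (Fin 2) ℂ)) : Matrix (Fin 2) (Fin 2) ℂ) +
              vecQuat ((((V (Site.shift (a.1.1 - Pi.single ν 1) a.1.2, ν))⁻¹ * (V (a.1.1 - Pi.single ν 1, a.1.2))⁻¹ * V (a.1.1 - Pi.single ν 1, ν))⁻¹ : (Matrix.specialUnitaryGroup (Fin 2) ℂ)) : Matrix (Fin 2) (Fin 2) ℂ))) (vecQuat ((V a.1 : (Matrix.specialUnitaryGroup (Fin 2) ℂ)) : Matrix (Fin 2) (Fin 2) ℂ)))) ^ 3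
          else kickJac (ε * ‖(∑ ν ∈ Finset.univ.erase a.1.2,
            (vecQuat (((V (Site.shift a.1.1 a.1.2, ν) * (V (Site.shift a.1.1 ν, a.1.2))⁻¹ * (V (a.1.1, ν))⁻¹)⁻¹ : (Matrix.specialUnitaryGroup (Fin 2) ℂ)) : Matrix (Fin 2) (Fin 2) ℂ) +
              vecQuat ((((V (Site.shift (a.1.1 - Pi.single ν 1) a.1.2, ν))⁻¹ * (V (a.1.1 - Pi.single ν 1, a.1.2))⁻¹ * V (a.1.1 - Pi.single ν 1, ν))⁻¹ : (Matrix.specialUnitaryGroup (Fin 2) ℂ)) : Matrix (Fin 2) (Fin 2) ℂ)))‖) 2 (angle (∑ ν ∈ Finset.univ.erase a.1.2,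
            (vecQuat (((V (Site.shift a.1.1 a.1.2, ν) * (V (Site.shift a.1.1 ν, a.1.2))⁻¹ * (V (a.1.1, ν))⁻¹)⁻¹ : (Matrix.specialUnitaryGroup (Fin 2) ℂ)) : Matrix (Fin 2) (Fin 2) ℂ) +
              vecQuat ((((V (Site.shift (a.1.1 - Pi.single ν 1) a.1.2, ν))⁻¹ * (V (a.1.1 - Pi.single ν 1, a.1.2))⁻¹ * V (a.1.1 - Pi.single ν 1, ν))⁻¹ : (Matrix.specialUnitaryGroup (Fin 2) ℂ)) : Matrix (Fin 2) (Fin 2) ℂ))) (vecQuat ((V a.1 : (Matrix.specialUnitaryGroup (Fin 2) ℂ)) : Matrix (Fin 2) (Fin 2) ℂ))))) := by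
  have h := isGaugeInvariant_su2WilsonFlowLOJacobian_mask (fun e : Edge d L => e.2 = μ ∧ χ e.1 = b) ε
  beta_reduce at h
  exact h

/-- **The booked density of a learned residual layer is gauge invariant when its weights are**
(`ρ (V^g) e ν s = ρ V e ν s` at active links): any mask, any step constant `c`. -/
theorem isGaugeInvariant_su2ResidualJacobian (c : ℝ)
    (ρ : GaugeConfig d L (Matrix.specialUnitaryGroup (Fin 2) ℂ) → Edge d L → Fin d → Fin 2 → ℝ)
    (hρ : ∀ (g : Site d L → Matrix.specialUnitaryGroup (Fin 2) ℂ)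
      (V : GaugeConfig d L (Matrix.specialUnitaryGroup (Fin 2) ℂ)) (e : Edge d L), p e →
        ∀ ν s, ρ (gaugeTransform g V) e ν s = ρ V e ν s) :
    IsGaugeInvariant (fun V : GaugeConfig d L (Matrix.specialUnitaryGroup (Fin 2) ℂ) => ∏ a : {e : Edge d L // p e},
      (if Real.sin (angle (∑ ν ∈ Finset.univ.erase a.1.2,
            (ρ V a.1 ν 0 • vecQuat (((V (Site.shift a.1.1 a.1.2, ν) * (V (Site.shift a.1.1 ν, a.1.2))⁻¹ * (V (a.1.1, ν))⁻¹)⁻¹ : Matrix.specialUnitaryGroup (Fin 2) ℂ) : Matrix (Fin 2) (Fin 2) ℂ) +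
              ρ V a.1 ν 1 • vecQuat ((((V (Site.shift (a.1.1 - Pi.single ν 1) a.1.2, ν))⁻¹ * (V (a.1.1 - Pi.single ν 1, a.1.2))⁻¹ * V (a.1.1 - Pi.single ν 1, ν))⁻¹ : Matrix.specialUnitaryGroup (Fin 2) ℂ) : Matrix (Fin 2) (Fin 2) ℂ)))
            (vecQuat ((V a.1 : Matrix.specialUnitaryGroup (Fin 2) ℂ) : Matrix (Fin 2) (Fin 2) ℂ))) = 0 then
          (1 - c * ‖∑ ν ∈ Finset.univ.erase a.1.2,
            (ρ V a.1 ν 0 • vecQuat (((V (Site.shift a.1.1 a.1.2, ν) * (V (Site.shift a.1.1 ν, a.1.2))⁻¹ * (V (a.1.1, ν))⁻¹)⁻¹ : Matrix.specialUnitaryGroup (Fin 2) ℂ) : Matrix (Fin 2) (Fin 2) ℂ) +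
              ρ V a.1 ν 1 • vecQuat ((((V (Site.shift (a.1.1 - Pi.single ν 1) a.1.2, ν))⁻¹ * (V (a.1.1 - Pi.single ν 1, a.1.2))⁻¹ * V (a.1.1 - Pi.single ν 1, ν))⁻¹ : Matrix.specialUnitaryGroup (Fin 2) ℂ) : Matrix (Fin 2) (Fin 2) ℂ))‖ *
            Real.cos (angle (∑ ν ∈ Finset.univ.erase a.1.2,
            (ρ V a.1 ν 0 • vecQuat (((V (Site.shift a.1.1 a.1.2, ν) * (V (Site.shift a.1.1 ν, a.1.2))⁻¹ * (V (a.1.1, ν))⁻¹)⁻¹ : Matrix.specialUnitaryGroup (Fin 2) ℂ) : Matrix (Fin 2) (Fin 2) ℂ) +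
              ρ V a.1 ν 1 • vecQuat ((((V (Site.shift (a.1.1 - Pi.single ν 1) a.1.2, ν))⁻¹ * (V (a.1.1 - Pi.single ν 1, a.1.2))⁻¹ * V (a.1.1 - Pi.single ν 1, ν))⁻¹ : Matrix.specialUnitaryGroup (Fin 2) ℂ) : Matrix (Fin 2) (Fin 2) ℂ)))
            (vecQuat ((V a.1 : Matrix.specialUnitaryGroup (Fin 2) ℂ) : Matrix (Fin 2) (Fin 2) ℂ)))) ^ 3
        else kickJac (c * ‖∑ ν ∈ Finset.univ.erase a.1.2,
            (ρ V a.1 ν 0 • vecQuat (((V (Site.shift a.1.1 a.1.2, ν) * (V (Site.shift a.1.1 ν, a.1.2))⁻¹ * (V (a.1.1, ν))⁻¹)⁻¹ : Matrix.specialUnitaryGroup (Fin 2) ℂ) : Matrix (Fin 2) (Fin 2) ℂ) +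
              ρ V a.1 ν 1 • vecQuat ((((V (Site.shift (a.1.1 - Pi.single ν 1) a.1.2, ν))⁻¹ * (V (a.1.1 - Pi.single ν 1, a.1.2))⁻¹ * V (a.1.1 - Pi.single ν 1, ν))⁻¹ : Matrix.specialUnitaryGroup (Fin 2) ℂ) : Matrix (Fin 2) (Fin 2) ℂ))‖) 2
            (angle (∑ ν ∈ Finset.univ.erase a.1.2,
            (ρ V a.1 ν 0 • vecQuat (((V (Site.shift a.1.1 a.1.2, ν) * (V (Site.shift a.1.1 ν, a.1.2))⁻¹ * (V (a.1.1, ν))⁻¹)⁻¹ : Matrix.specialUnitaryGroup (Fin 2) ℂ) : Matrix (Fin 2) (Fin 2) ℂ) +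
              ρ V a.1 ν 1 • vecQuat ((((V (Site.shift (a.1.1 - Pi.single ν 1) a.1.2, ν))⁻¹ * (V (a.1.1 - Pi.single ν 1, a.1.2))⁻¹ * V (a.1.1 - Pi.single ν 1, ν))⁻¹ : Matrix.specialUnitaryGroup (Fin 2) ℂ) : Matrix (Fin 2) (Fin 2) ℂ)))
            (vecQuat ((V a.1 : Matrix.specialUnitaryGroup (Fin 2) ℂ) : Matrix (Fin 2) (Fin 2) ℂ))))) := by
  have h := isGaugeInvariant_su2MaskedKickJacobian p c
    (fun (V : GaugeConfig d L (Matrix.specialUnitaryGroup (Fin 2) ℂ)) (e : Edge d L) => ∑ ν ∈ Finset.univ.erase e.2,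
      (ρ V e ν 0 • vecQuat (((V (Site.shift e.1 e.2, ν) * (V (Site.shift e.1 ν, e.2))⁻¹ * (V (e.1, ν))⁻¹)⁻¹ : Matrix.specialUnitaryGroup (Fin 2) ℂ) : Matrix (Fin 2) (Fin 2) ℂ) +
        ρ V e ν 1 • vecQuat ((((V (Site.shift (e.1 - Pi.single ν 1) e.2, ν))⁻¹ * (V (e.1 - Pi.single ν 1, e.2))⁻¹ * V (e.1 - Pi.single ν 1, ν))⁻¹ : Matrix.specialUnitaryGroup (Fin 2) ℂ) : Matrix (Fin 2) (Fin 2) ℂ)))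
    (fun g V e he => by
      beta_reduce
      have hw : (∑ ν ∈ Finset.univ.erase e.2,
          (ρ (gaugeTransform g V) e ν 0 • vecQuat ((((gaugeTransform g V) (Site.shift e.1 e.2, ν) * ((gaugeTransform g V) (Site.shift e.1 ν, e.2))⁻¹ * ((gaugeTransform g V) (e.1, ν))⁻¹)⁻¹ : Matrix.specialUnitaryGroup (Fin 2) ℂ) : Matrix (Fin 2) (Fin 2) ℂ) +
            ρ (gaugeTransform g V) e ν 1 • vecQuat (((((gaugeTransform g V) (Site.shift (e.1 - Pi.single ν 1) e.2, ν))⁻¹ * ((gaugeTransform g V) (e.1 - Pi.single ν 1, e.2))⁻¹ * (gaugeTransform g V) (e.1 - Pi.single ν 1, ν))⁻¹ : Matrix.specialUnitaryGroup (Fin 2) ℂ) : Matrix (Fin 2) (Fin 2) ℂ))) =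
          ∑ ν ∈ Finset.univ.erase e.2,
          (ρ V e ν 0 • vecQuat ((((gaugeTransform g V) (Site.shift e.1 e.2, ν) * ((gaugeTransform g V) (Site.shift e.1 ν, e.2))⁻¹ * ((gaugeTransform g V) (e.1, ν))⁻¹)⁻¹ : Matrix.specialUnitaryGroup (Fin 2) ℂ) : Matrix (Fin 2) (Fin 2) ℂ) +
            ρ V e ν 1 • vecQuat (((((gaugeTransform g V) (Site.shift (e.1 - Pi.single ν 1) e.2, ν))⁻¹ * ((gaugeTransform g V) (e.1 - Pi.single ν 1, e.2))⁻¹ * (gaugeTransform g V) (e.1 - Pi.single ν 1, ν))⁻¹ : Matrix.specialUnitaryGroup (Fin 2) ℂ) : Matrix (Fin 2) (Fin 2) ℂ)) :=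
        Finset.sum_congr rfl fun ν _ => by rw [hρ g V e he ν 0, hρ g V e he ν 1]
      rw [hw]
      have h2 := quatVec_weightedStapleJ_gaugeTransform g V e (fun ν s => ρ V e ν s)
      beta_reduce at h2
      exact h2)
  beta_reduce at h
  exact h

end Layer

/-! ## Members: a schedule of equivariant layers with invariant log-dets (any group) -/

section Member

variable {G : Type*} [Group G] [MeasurableSpace G]

/-- **A member composed of gauge-equivariant layers is gauge equivariant** (the composite
`F_n ∘ ⋯ ∘ F_1` in the `foldr … trans` packaging of `hasJacobian_foldr_trans`). -/
theorem isGaugeEquivariant_foldr_trans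
    (layers : List ((GaugeConfig d L G ≃ᵐ GaugeConfig d L G) × (GaugeConfig d L G → ℝ)))
    (hF : ∀ Ly ∈ layers, IsGaugeEquivariant (⇑Ly.1)) :
    IsGaugeEquivariant
      (⇑(layers.foldr (fun Ly (F : GaugeConfig d L G ≃ᵐ GaugeConfig d L G) => Ly.1.trans F)
        (MeasurableEquiv.refl (GaugeConfig d L G)))) := by
  induction layers with
  | nil => intro g U; rfl
  | cons Ly rest ih =>
    rw [List.foldr_cons, MeasurableEquiv.coe_trans]
    exact (ih fun L hL => hF L (List.mem_cons_of_mem _ hL)).comp (hF Ly (List.mem_cons.mpr (Or.inl rfl)))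

/-- **The running log-det of such a member is gauge invariant**: the accumulated density
`v ↦ J_1(v) · J_2(F_1 v) ⋯ J_n(F_{n−1} ⋯ F_1 v)` (the `foldr` of `hasJacobian_foldr_trans`) is
`IsGaugeInvariant` when every layer is equivariant with an invariant booked density. -/
theorem isGaugeInvariant_foldr_logDet
    (layers : List ((GaugeConfig d L G ≃ᵐ GaugeConfig d L G) × (GaugeConfig d L G → ℝ)))
    (hF : ∀ Ly ∈ layers, IsGaugeEquivariant (⇑Ly.1)) (hJ : ∀ Ly ∈ layers, IsGaugeInvariant Ly.2) :
    IsGaugeInvariant (layers.foldr (fun Ly K => fun v => Ly.2 v * K (Ly.1 v)) (fun _ => (1 : ℝ))) := by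
  induction layers with
  | nil => intro g U; rfl
  | cons Ly rest ih =>
    intro g U
    have ih' := ih (fun L hL => hF L (List.mem_cons_of_mem _ hL)) (fun L hL => hJ L (List.mem_cons_of_mem _ hL))
    simp only [List.foldr_cons]
    rw [hJ Ly (List.mem_cons.mpr (Or.inl rfl)) g U, hF Ly (List.mem_cons.mpr (Or.inl rfl)) g U, ih' g]

/-- **Transfer through the `exists_layers_*` packaging.**  If the layers' forward maps and
densities ARE, position by position, maps `Fm s` and densities `Jm s` indexed by a schedule
(`layers.map … = sched.map …`, as every `exists_layers_*` theorem states) and each `Fm s` is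
equivariant with `Jm s` invariant, then every layer is equivariant with an invariant density —
so `isGaugeEquivariant_foldr_trans` / `isGaugeInvariant_foldr_logDet` apply to the member. -/
theorem gauge_of_layers_map_eq {σ : Type*}
    (layers : List ((GaugeConfig d L G ≃ᵐ GaugeConfig d L G) × (GaugeConfig d L G → ℝ)))
    (sched : List σ) (Fm : σ → GaugeConfig d L G → GaugeConfig d L G) (Jm : σ → GaugeConfig d L G → ℝ)
    (hmap : layers.map (fun Ly => ((Ly.1 : GaugeConfig d L G → GaugeConfig d L G), Ly.2)) =
      sched.map (fun s => (Fm s, Jm s)))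
    (hF : ∀ s ∈ sched, IsGaugeEquivariant (Fm s)) (hJ : ∀ s ∈ sched, IsGaugeInvariant (Jm s)) :
    (∀ Ly ∈ layers, IsGaugeEquivariant (⇑Ly.1)) ∧ (∀ Ly ∈ layers, IsGaugeInvariant Ly.2) := by
  have key : ∀ Ly ∈ layers, ∃ s ∈ sched, (Fm s, Jm s) = ((Ly.1 : GaugeConfig d L G → GaugeConfig d L G), Ly.2) := by
    intro Ly hLy
    have hmem : ((Ly.1 : GaugeConfig d L G → GaugeConfig d L G), Ly.2) ∈
        sched.map (fun s => (Fm s, Jm s)) := by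
      rw [← hmap]
      exact List.mem_map.mpr ⟨Ly, hLy, rfl⟩
    exact List.mem_map.mp hmem
  refine ⟨fun Ly hLy => ?_, fun Ly hLy => ?_⟩
  · obtain ⟨s, hs, hEq⟩ := key Ly hLy
    rw [← (Prod.mk.inj hEq).1]
    exact hF s hs
  · obtain ⟨s, hs, hEq⟩ := key Ly hLy
    rw [← (Prod.mk.inj hEq).2]
    exact hJ s hs

end Member

/-! ## The pulled-back action `S∘F − log J` is gauge invariant -/

section Action

variable {G : Type*} [Group G]

/-- **The configuration part of the FT-HMC Hamiltonian, `S(F V) − log J(V)`, is gauge invariant**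
for an invariant action `S`, an equivariant map `F` and an invariant booked density `J` — the
effective action the engine differentiates is a class function of the field. -/
theorem isGaugeInvariant_ftAction {S : GaugeConfig d L G → ℝ} (hS : IsGaugeInvariant S)
    {F : GaugeConfig d L G → GaugeConfig d L G} (hF : IsGaugeEquivariant F)
    {J : GaugeConfig d L G → ℝ} (hJ : IsGaugeInvariant J) :
    IsGaugeInvariant (fun V : GaugeConfig d L G => S (F V) - Real.log (J V)) := by
  intro g U
  show S (F (gaugeTransform g U)) - Real.log (J (gaugeTransform g U)) = S (F U) - Real.log (J U)
  rw [hF g U, hS g (F U), hJ g U]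

/-- The same with the Wilson action (times a coupling `β`) as `S`, for any matrix
representation `ρ` — by the tree's `isGaugeInvariant_wilsonAction`. -/
theorem isGaugeInvariant_ftAction_wilson {N : ℕ} [NeZero L] (ρ : G →* Matrix (Fin N) (Fin N) ℂ) (β : ℝ)
    {F : GaugeConfig d L G → GaugeConfig d L G} (hF : IsGaugeEquivariant F)
    {J : GaugeConfig d L G → ℝ} (hJ : IsGaugeInvariant J) :
    IsGaugeInvariant (fun V : GaugeConfig d L G => β * wilsonAction ρ (F V) - Real.log (J V)) :=
  isGaugeInvariant_ftAction (S := fun V => β * wilsonAction ρ V)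
    (fun g U => by simp only [wilsonAction_gaugeTransform]) hF hJ

end Action

end Summit.Ventures.LatticeQCDFlow.Exactness
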